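import Mathlib
import Summits.ValiantsHypothesis.ValiantsHypothesis.Theorems.ValuativeGCTValuativeFlipSeedTwoRow
import Summits.ValiantsHypothesis.ValiantsHypothesis.Theorems.ValuativeGCTValuativeFlipSeedLiftPer
import Literature.Computability.AlgebraicComplexity.BIPPaddingDegenerations
import Literature.Computability.AlgebraicComplexity.BinarySemiInvariants

/-!
# Explicit padded-permanent highest-weight vectors, III: the Hessian seed — an explicit nonzero
# highest-weight vector of weight `(2m-2, 2)*` in `ℂ[Δ_m(X₀₀^{m-n} per_n)]` for all `2 ≤ n ≤ m`

Wall-breaker axis k5 ("explicit padded-permanent highest-weight vectors for `stub_seedRichness`") of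
crux `ValuativeGCT.ValuativeFlip` (stmt-ValiantsHypothesis-12624): the first fully explicit instance
of the seed-lift pipeline (`ValuativeGCTValuativeFlipSeedLift.lean`, `…SeedTwoRow.lean`) run end to end.

* **Seed.** The Hessian source `hessianSource ℂ n = 2n·X_{x₁^n}X_{x₀²x₁^{n-2}} - (n-1)·X_{x₀x₁^{n-1}}²`
  of binary `n`-ics (`Literature/…/BinarySemiInvariants.lean`, a highest-weight vector of
  `ℂ[Sym^n ℂ²]` of weight `(-2, -(2n-2))`), transported along the top-two embedding `ι` to
  `G_n ∈ ℂ[Sym^n ℂ^{n²}]`: an EXPLICIT `B`-semi-invariant of weight `(2n-2, 2)*`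
  (`partitionWeightLex n λ₂`), i.e. `2n·c(x_top^n)·c(x_top^{n-2}y²) - (n-1)·c(x_top^{n-1}y)²` in the
  coefficients `c(·)` of an `n`-ic, `y` the second greatest variable.
* **Certification point.** `q = x_top^{n-1} · y` is `B · per_n` for the substitution collapsing
  `per_n` to the product of its diagonal (`X_pow_mul_X_mem_endOrbit_paddedPerFormLex`), is top-PURE of
  degree `n - 1` in `x_top`, and `G_n(q) = -(n-1) ≠ 0` (`aeval_formCoeff_hessianSeed`).
* **Generic form** (`hasHighestWeight_paddedPer_of_binarySeed`): ANY semi-invariant `G₂` of binary `n`-ics of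
  binary weight `(-b,-a)` (`0 < b ≤ a`, `a + b = nδ`) that does not vanish at ONE top-pure `q ∈ End · per_n`
  (after transport) makes the two-row partition `(a + jδ, b)` occur in `ℂ[Δ_{n+j}(X₀₀^j per_n)]` for EVERY
  `j`, with the explicit highest-weight vector `[liftHWV n j (G₂ ∘ res)]` — the entry point for every further
  transvectant source.
* **Conclusion** (`hasHighestWeight_paddedPer_hessian`, `orbitMultiplicity_paddedPer_hessian_pos`): for
  all `2 ≤ n ≤ m`, the class of `liftHWV n (m-n) G_n` is a NONZERO highest-weight vector of weight
  `(2m-2, 2)* = (Weight.dualOfPartition (m*m) λ).toMatIdx`, `λ = (2m-2, 2) ⊢ 2m`, in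
  `OrbitCoordRing (paddedPerFormLex ℂ n m) m`; in particular `mult_{(2m-2,2)*} ℂ[Δ_m(X₀₀^{m-n}per_n)] ≥ 1`
  with an explicit witness.  (A two-row shape: it occurs on the determinant side as well — this is a
  seed, not an obstruction; its role is to instantiate the explicit-seed residual of `stub_seedRichness`
  at `D = 0` and to fix the bookkeeping for every further semi-invariant of binary forms.)

No definitions; sorry-free. [BIP 2019 §5; Kadish–Landsberg 2014 §1; Hilbert, Theory of Algebraic
Invariants I.8–9 (Hessian source)]
-/

set_option linter.dupNamespace false

namespace Summit.ValiantsHypothesis.ValiantsHypothesis.Theorems.ValuativeFlip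

open MvPolynomial
open scoped BigOperators Matrix
open Literature.NumberTheory.DiophantineGeometry Literature.Computability.AlgebraicComplexity
open Literature.Computability.Complexity (liftHWV paddedForm rowLift partitionWeightLex topMatIdx
  le_topMatIdx liftHWV_mem_highestWeightSpace aeval_formCoeff_rename_degIdxMap)
open Literature.Barriers.ValiantsHypothesis (degIdxMap rename_mem_highestWeightSpace_coordRep)

noncomputable section

/-! ## The certification point `x_top^{n-1} · y` is a collapsed permanent -/

/-- `per_n` in the lexicographic `n²` variables: `paddedPerFormLex ℂ n n` is the renamed generic
permanent of the (full) block `BlockIdx n n` (padding exponent `n - n = 0`). [Mulmuley–Sohoni 2001 §4] -/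
theorem paddedPerFormLex_self (n : ℕ) [NeZero n] :
    paddedPerFormLex ℂ n n =
      rename (fun ij : BlockIdx n n × BlockIdx n n => (toLex ((ij.1 : Fin n), (ij.2 : Fin n)) : MatIdx n))
        (perPoly (BlockIdx n n) ℂ) := by
  rw [Literature.Computability.Complexity.paddedPerFormLex_eq,
    show (X (toLex ((0 : Fin n), (0 : Fin n))) : MvPolynomial (MatIdx n) ℂ) ^ (n - n) = 1 by
      rw [Nat.sub_self, pow_zero], one_mul]

/-- **`x_top^{n-1} · (t y) ∈ End · per_n`** (`per_n = paddedPerFormLex ℂ n n` in the lexicographic `n²`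
variables, any variable `y`, any scalar `t`): substitute `x_top` for the first `n - 1` diagonal variables,
`t·y` for the last one and `0` for every off-diagonal variable; the permanent of a diagonal matrix is the
product of its diagonal (`Matrix.permanent_diagonal`).  The scalar `t` parametrises a LINE of
certification points (used for transcendence, `…SeedHessianIndependent.lean`).
[Mulmuley–Sohoni 2001 §4; folklore] -/
theorem X_pow_mul_C_mul_X_mem_endOrbit_paddedPerFormLex (n : ℕ) [NeZero n] (t : ℂ) (y : MatIdx n) :
    X (topMatIdx n) ^ (n - 1) * (C t * X y) ∈ endOrbit (MatIdx n) ℂ (paddedPerFormLex ℂ n n) := by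
  classical
  -- the last diagonal block index
  have hn1 : n - 1 < n := Nat.sub_one_lt (NeZero.ne n)
  let a₀ : BlockIdx n n := ⟨⟨n - 1, hn1⟩, by simp⟩
  let d : BlockIdx n n → MvPolynomial (MatIdx n) ℂ :=
    fun a => if a = a₀ then C t * X y else X (topMatIdx n)
  let L : MatIdx n → MvPolynomial (MatIdx n) ℂ := fun i =>
    if (ofLex i).1 = (ofLex i).2 then
      (if ((ofLex i).1 : ℕ) = n - 1 then C t * X y else X (topMatIdx n)) else 0
  have hty : (C t * X y : MvPolynomial (MatIdx n) ℂ).IsHomogeneous 1 := by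
    simpa using (isHomogeneous_C (MatIdx n) t).mul (isHomogeneous_X ℂ y)
  have hL : ∀ i, (L i).IsHomogeneous 1 := by
    intro i
    simp only [L]
    split_ifs
    · exact hty
    · exact isHomogeneous_X ℂ _
    · exact isHomogeneous_zero _ _ _
  have key : aeval L (paddedPerFormLex ℂ n n) = X (topMatIdx n) ^ (n - 1) * (C t * X y) := by
    rw [paddedPerFormLex_self, aeval_rename, aeval_perPoly]
    have hmat : (Matrix.of fun a b : BlockIdx n n =>
        (L ∘ fun ij : BlockIdx n n × BlockIdx n n =>
          (toLex ((ij.1 : Fin n), (ij.2 : Fin n)) : MatIdx n)) (a, b)) = Matrix.diagonal d := by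
      ext a b
      simp only [Matrix.of_apply, Function.comp_apply, L, ofLex_toLex, Matrix.diagonal_apply, d]
      by_cases hab : a = b
      · subst hab
        rw [if_pos rfl, if_pos rfl]
        by_cases ha : a = a₀
        · rw [if_pos ha, if_pos (by rw [ha])]
        · rw [if_neg ha, if_neg]
          intro h
          exact ha (Subtype.ext (Fin.ext h))
      · rw [if_neg (fun h => hab (Subtype.ext h)), if_neg hab]
    rw [hmat, Matrix.permanent_diagonal, ← Finset.mul_prod_erase _ _ (Finset.mem_univ a₀)]
    simp only [d, if_pos rfl]
    rw [Finset.prod_congr rfl fun a ha => if_neg (Finset.ne_of_mem_erase ha), Finset.prod_const,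
      Finset.card_erase_of_mem (Finset.mem_univ a₀), Finset.card_univ, card_blockIdx (le_refl n),
      mul_comm]
  rw [← key]
  exact psl_aeval_linear_mem_endOrbit L hL _

/-- **`x_top^{n-1} · y ∈ End · per_n`** (the case `t = 1` of
`X_pow_mul_C_mul_X_mem_endOrbit_paddedPerFormLex`): the collapsed diagonal permanent. [folklore] -/
theorem X_pow_mul_X_mem_endOrbit_paddedPerFormLex (n : ℕ) [NeZero n] (y : MatIdx n) :
    X (topMatIdx n) ^ (n - 1) * X y ∈ endOrbit (MatIdx n) ℂ (paddedPerFormLex ℂ n n) := by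
  simpa using X_pow_mul_C_mul_X_mem_endOrbit_paddedPerFormLex n 1 y

/-- `x_top^{n-1} · y` is a form of degree `n` (`1 ≤ n`). [folklore] -/
theorem isHomogeneous_X_pow_mul_X (n : ℕ) [NeZero n] (y : MatIdx n) :
    (X (topMatIdx n) ^ (n - 1) * X y : MvPolynomial (MatIdx n) ℂ).IsHomogeneous n := by
  have h := ((isHomogeneous_X ℂ (topMatIdx n)).pow (n - 1)).mul (isHomogeneous_X ℂ y)
  rwa [one_mul, Nat.sub_add_cancel (Nat.one_le_iff_ne_zero.mpr (NeZero.ne n))] at h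

/-- `x_top^{n-1} · y` is top-pure of degree `n - 1` in `x_top` (`y ≠ x_top`). [folklore] -/
theorem apply_top_of_mem_support_X_pow_mul_X (n : ℕ) [NeZero n] {y : MatIdx n} (hy : y ≠ topMatIdx n) :
    ∀ e ∈ (X (topMatIdx n) ^ (n - 1) * X y : MvPolynomial (MatIdx n) ℂ).support, e (topMatIdx n) = n - 1 := by
  classical
  intro e he
  rw [X_pow_eq_monomial, X, monomial_mul, mul_one, support_monomial, if_neg one_ne_zero,
    Finset.mem_singleton] at he
  subst he
  simp [hy]

/-! ## The transported Hessian source and its value at the certification point -/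

/-- **The value of the transported Hessian source at `x_top^{n-1} · y`** (`y = ι 0` the second
greatest variable): `-(n - 1)` — of the three coefficients `c(x_top^n), c(x_top^{n-1}y), c(x_top^{n-2}y²)`
only the middle one is nonzero (`= 1`). [this file] -/
theorem aeval_formCoeff_hessianSeed (n : ℕ) [NeZero n] (hn : 2 ≤ n) {ι : Fin 2 → MatIdx n}
    (hι : StrictMono ι) (hι1 : ι 1 = topMatIdx n) :
    aeval (formCoeff n (X (topMatIdx n) ^ (n - 1) * X (ι 0)))
      (rename (degIdxMap hι.injective) (hessianSource ℂ n)) = -((n : ℂ) - 1) := by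
  classical
  have hq : (X (topMatIdx n) ^ (n - 1) * X (ι 0) : MvPolynomial (MatIdx n) ℂ) =
      rename ι (X 1 ^ (n - 1) * X 0) := by
    rw [map_mul, map_pow, rename_X, rename_X, hι1]
  rw [aeval_formCoeff_rename_degIdxMap hι.injective, hq, killCompl_rename_app, aeval_hessianSource]
  have hmon : (X 1 ^ (n - 1) * X 0 : MvPolynomial (Fin 2) ℂ) =
      monomial (Finsupp.single 1 (n - 1) + Finsupp.single 0 1) 1 := by
    rw [X_pow_eq_monomial, X, monomial_mul, mul_one]
  have hcoef : ∀ p, p ≤ 2 → formCoeff n (X 1 ^ (n - 1) * X 0 : MvPolynomial (Fin 2) ℂ) (binIdx n p) =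
      if p = 1 then 1 else 0 := by
    intro p hp
    rw [formCoeff_apply, hmon, coeff_monomial]
    have hiff : (Finsupp.single 1 (n - 1) + Finsupp.single 0 1 = (binIdx n p).1) ↔ p = 1 := by
      rw [DFunLike.ext_iff, Fin.forall_fin_two]
      simp
      omega
    by_cases h1 : p = 1
    · rw [if_pos (hiff.mpr h1), if_pos h1]
    · rw [if_neg (fun h => h1 (hiff.mp h)), if_neg h1]
  rw [hcoef 0 (by norm_num), hcoef 1 (by norm_num), hcoef 2 le_rfl]
  norm_num

/-! ## Two-row binary seeds certified at one top-pure collapsed permanent occur at every padding -/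

/-- **Occurrence at every padding from ONE binary seed and ONE top-pure value** (the generic form of the
Hessian instance below).  Data at size `n ≥ 2`: the top-two embedding `ι`; a highest-weight vector `G₂`
of `ℂ[Sym^n ℂ²]` of binary weight `(-b, -a)` (`0 < b ≤ a`, `a + b = nδ`) and degree `δ` — a semi-invariant
of binary `n`-ics; a top-PURE form `q` of degree `n` in the endomorphism orbit of `per_n`
(`paddedPerFormLex ℂ n n`) at which the transported seed `G = G₂ ∘ (restriction to x_{ι 0}, x_{ι 1})`
does not vanish.  Conclusion: for EVERY padding `j`, the two-row partition `λ = (a + jδ, b) ⊢ (n+j)δ`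
occurs in `ℂ[Δ_{n+j}(X₀₀^j per_n)] = OrbitCoordRing (paddedPerFormLex ℂ n (n+j)) (n+j)`, the class of
`liftHWV n j G` being a nonzero highest-weight vector of weight `partitionWeightLex (n+j) λ`.
Chain: transport (`rename_mem_highestWeightSpace_coordRep`, `partitionWeightLex_eq_extend_pair`) → lift
(`liftHWV_mem_highestWeightSpace`, `partitionWeightLex_rowLift_pair`) → reduction
(`psl_mk_mem_highestWeightSpace`) → nonvanishing at `x_top^j q♯ ∈ End · X₀₀^j per_n`
(`psl_paddedForm_linSubst_per_mem_endOrbit`, `mk_liftHWV_ne_zero_of_topPure`). [this file] -/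
theorem hasHighestWeight_paddedPer_of_binarySeed (n j : ℕ) [NeZero n] [NeZero (n + j)] (hn : 2 ≤ n)
    {ι : Fin 2 → MatIdx n} (hι : StrictMono ι) (hup : IsUpperSet (Set.range ι))
    (hι1 : ι 1 = topMatIdx n) (hι0 : (((matIdxEquiv n).symm (ι 0) : Fin (n * n)) : ℕ) = n * n - 2)
    {G₂ : MvPolynomial (DegIdx (Fin 2) n) ℂ} {a b δ : ℕ} (hab : b ≤ a) (hb : 0 < b)
    (hsum : a + b = n * δ)
    (hG₂ : G₂ ∈ highestWeightSpace (coordRep (Fin 2) ℂ n) ![-(b : ℤ), -(a : ℤ)])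
    (hG₂δ : G₂.IsHomogeneous δ)
    {q : MvPolynomial (MatIdx n) ℂ} (hq : q.IsHomogeneous n) {r : ℕ}
    (hqr : ∀ e ∈ q.support, e (topMatIdx n) = r)
    (hqmem : q ∈ endOrbit (MatIdx n) ℂ (paddedPerFormLex ℂ n n))
    (hval : aeval (formCoeff n q) (rename (degIdxMap hι.injective) G₂) ≠ 0)
    (lam : Nat.Partition ((n + j) * δ)) (hlam : lam.parts = {a + j * δ, b}) :
    HasHighestWeight (orbitCoordRep (paddedPerFormLex ℂ n (n + j)) (n + j))
      (partitionWeightLex (n + j) lam) := by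
  classical
  have ha : 0 < a := lt_of_lt_of_le hb hab
  -- the inner two-row partition `(a, b) ⊢ nδ`
  let lam₂ : Nat.Partition (n * δ) :=
    ⟨{a, b}, by
      intro i hi
      simp only [Multiset.insert_eq_cons, Multiset.mem_cons, Multiset.mem_singleton] at hi
      omega, by
      simp only [Multiset.insert_eq_cons, Multiset.sum_cons, Multiset.sum_singleton]
      omega⟩
  have hlam₂ : lam₂.parts = {a, b} := rfl
  have hcard : lam₂.parts.card ≤ n * n := by
    rw [hlam₂]
    simp only [Multiset.insert_eq_cons, Multiset.card_cons, Multiset.card_singleton]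
    nlinarith
  -- the transported seed and its weight
  set G : MvPolynomial (DegIdx (MatIdx n) n) ℂ := rename (degIdxMap hι.injective) G₂ with hG_def
  have hG : G ∈ highestWeightSpace (coordRep (MatIdx n) ℂ n) (partitionWeightLex n lam₂) := by
    rw [partitionWeightLex_eq_extend_pair hι hι1 hι0 lam₂ hab hlam₂]
    exact rename_mem_highestWeightSpace_coordRep hι hup hG₂
  have hGδ : G.IsHomogeneous δ := hG₂δ.rename_isHomogeneous (f := degIdxMap hι.injective)
  -- the lift is a highest-weight vector of weight `(λ₂♯(n+j))* = partitionWeightLex (n+j) lam`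
  have hlift := liftHWV_mem_highestWeightSpace lam₂ hcard j hG
  rw [partitionWeightLex_rowLift_pair lam₂ lam hab hlam₂ hlam] at hlift
  have hclass := psl_mk_mem_highestWeightSpace (paddedPerFormLex ℂ n (n + j)) (n + j) _ hlift
  -- nonvanishing at the padded top-pure point
  obtain ⟨B, hB⟩ := hqmem
  have hmem : paddedForm n j q ∈ endOrbit (MatIdx (n + j)) ℂ (paddedPerFormLex ℂ n (n + j)) := by
    have h := psl_paddedForm_linSubst_per_mem_endOrbit n j B
    dsimp only at hB
    rwa [hB] at h
  have hne := mk_liftHWV_ne_zero_of_topPure n j hGδ (paddedPerFormLex ℂ n (n + j)) hq hqr hmem hval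
  rw [hasHighestWeight_iff_exists]
  exact ⟨_, hne, hclass⟩

/-! ## The Hessian seed gives a nonzero highest-weight vector of weight `(2m-2, 2)*` for all `m ≥ n ≥ 2` -/

/-- **Explicit occurrence of `(2(n+j)-2, 2)` in `ℂ[Δ_{n+j}(X₀₀^j per_n)]`, with an explicit
highest-weight vector.**  For `n ≥ 2`, every padding `j`, and `λ` the partition with parts
`{2(n+j)-2, 2}`: the class of the lift `liftHWV n j G_n` of the transported Hessian source `G_n` is a
nonzero highest-weight vector of weight `partitionWeightLex (n+j) λ = (Weight.dualOfPartition ((n+j)²) λ).toMatIdx`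
in `OrbitCoordRing (paddedPerFormLex ℂ n (n+j)) (n+j)` — `hasHighestWeight_paddedPer_of_binarySeed` with the
Hessian source (`hessianSource_mem_highestWeightSpace`, weight `(-2, -(2n-2))`, degree `2`) certified at
the collapsed permanent `q = x_top^{n-1}·y` (`X_pow_mul_X_mem_endOrbit_paddedPerFormLex`, top-pure of
degree `n - 1`, value `-(n-1) ≠ 0` by `aeval_formCoeff_hessianSeed`). [this file] -/
theorem hasHighestWeight_paddedPer_hessian (n j : ℕ) [NeZero n] [NeZero (n + j)] (hn : 2 ≤ n)
    (lam : Nat.Partition ((n + j) * 2)) (hlam : lam.parts = {2 * (n + j) - 2, 2}) :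
    HasHighestWeight (orbitCoordRep (paddedPerFormLex ℂ n (n + j)) (n + j))
      (partitionWeightLex (n + j) lam) := by
  classical
  obtain ⟨ι, hι, hup, hι1, hι0⟩ := exists_topTwoEmb n hn
  have hvec : (![(-2 : ℤ), -(2 * (n : ℤ) - 2)] : Fin 2 → ℤ) =
      ![-((2 : ℕ) : ℤ), -((2 * n - 2 : ℕ) : ℤ)] := by
    have h2n : 2 ≤ 2 * n := by omega
    funext i
    fin_cases i
    · simp
    · simp [Nat.cast_sub h2n]
  have hG₂ : hessianSource ℂ n ∈ highestWeightSpace (coordRep (Fin 2) ℂ n)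
      ![-((2 : ℕ) : ℤ), -((2 * n - 2 : ℕ) : ℤ)] := by
    rw [← hvec]
    exact hessianSource_mem_highestWeightSpace hn
  have hy : ι 0 ≠ topMatIdx n := by
    rw [← hι1]
    exact fun h => absurd (hι.injective h) (by decide)
  have hval : aeval (formCoeff n (X (topMatIdx n) ^ (n - 1) * X (ι 0) : MvPolynomial (MatIdx n) ℂ))
      (rename (degIdxMap hι.injective) (hessianSource ℂ n)) ≠ 0 := by
    rw [aeval_formCoeff_hessianSeed n hn hι hι1, neg_ne_zero, sub_ne_zero]
    exact_mod_cast (show n ≠ 1 by omega)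
  exact hasHighestWeight_paddedPer_of_binarySeed n j hn hι hup hι1 hι0 (a := 2 * n - 2) (b := 2) (δ := 2)
    (by omega) (by norm_num) (by omega) hG₂ (isHomogeneous_hessianSource n)
    (isHomogeneous_X_pow_mul_X n (ι 0)) (apply_top_of_mem_support_X_pow_mul_X n hy)
    (X_pow_mul_X_mem_endOrbit_paddedPerFormLex n (ι 0)) hval lam (by rw [hlam]; congr 1; omega)

/-- **The same for all `2 ≤ n ≤ m`, in the crux's own weights**: `λ = (2m-2, 2) ⊢ 2m` occurs in
`ℂ[Δ_m(X₀₀^{m-n} per_n)]`, `(Weight.dualOfPartition (m*m) λ).toMatIdx` having a nonzero, explicit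
highest-weight vector. [this file] -/
theorem hasHighestWeight_paddedPer_hessian' {n m : ℕ} [NeZero n] [NeZero m] (hn : 2 ≤ n) (hnm : n ≤ m)
    (lam : Nat.Partition (m * 2)) (hlam : lam.parts = {2 * m - 2, 2}) :
    HasHighestWeight (orbitCoordRep (paddedPerFormLex ℂ n m) m)
      ((Weight.dualOfPartition (m * m) lam).toMatIdx : Weight (MatIdx m)) := by
  obtain ⟨j, rfl⟩ := Nat.exists_eq_add_of_le hnm
  exact hasHighestWeight_paddedPer_hessian n j hn lam hlam

/-- **`mult_{(2m-2,2)*} ℂ[Δ_m(X₀₀^{m-n} per_n)] ≥ 1` for all `2 ≤ n ≤ m`**, with the explicit witness of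
`hasHighestWeight_paddedPer_hessian` (the highest-weight space is finite-dimensional,
`finiteDimensional_highestWeightSpace_orbitCoordRep_holds`). [this file] -/
theorem orbitMultiplicity_paddedPer_hessian_pos {n m : ℕ} [NeZero n] [NeZero m] (hn : 2 ≤ n)
    (hnm : n ≤ m) (lam : Nat.Partition (m * 2)) (hlam : lam.parts = {2 * m - 2, 2}) :
    0 < orbitMultiplicity ℂ (paddedPerFormLex ℂ n m) m
      ((Weight.dualOfPartition (m * m) lam).toMatIdx : Weight (MatIdx m)) := by
  have h := hasHighestWeight_paddedPer_hessian' hn hnm lam hlam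
  haveI := finiteDimensional_highestWeightSpace_orbitCoordRep_holds (k := ℂ) (paddedPerFormLex ℂ n m)
    (NeZero.ne m) ((Weight.dualOfPartition (m * m) lam).toMatIdx : Weight (MatIdx m))
  rw [orbitMultiplicity, hwMultiplicity]
  exact Nat.pos_of_ne_zero fun h0 => h (Submodule.finrank_eq_zero.mp h0)

end

end Summit.ValiantsHypothesis.ValiantsHypothesis.Theorems.ValuativeFlip
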